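import Summits.RiemannHypothesis.RiemannHypothesis.Theorems.HandoffWindow
import Summits.RiemannHypothesis.RiemannHypothesis.Theorems.MotivicDoorSemilocalThreshold
import HarnessLib

/-!
# The HANDOFF decomposition, statement file: `H(q)`, `Base`, `Step`, `Target` — and `RH ↔ Base ∧ ∀ q prime, H q` is a THEOREM

Cell `rh-explicit`, TRACK «HANDOFF» (coordinator 2026-08-23; seat handoff-theory-1 = statement owner).  Companion
text: `HOME/handoff/HANDOFF-STATEMENT.md` (definitions as printed, logical status, what is OPEN).  This file BUILDS
ON the accepted `Theorems/HandoffWindow.lean` (seat prove-2: the window identity `Re Q = contribution − deficit`,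
the two-argument `Handoff.HandoffH q q'` for consecutive primes, `Handoff.handoffH_iff_weilPositivityOn`,
`Handoff.riemannHypothesis_iff_forall_handoffH`) and re-declares nothing of it.

HONEST FRAMING: nothing here is a step towards RH.  Every equivalence below is an EXACT REWRITING of the tree's
`riemannHypothesis_iff_forall_weilPositivityOn` (Weil 1952 / Bombieri 2000 Thm 2 / Yoshida 1992, discharged in
the tree); every `H q` for `q ≥ 3` is OPEN and the conjunction of all of them is the Riemann hypothesis itself.

## The objects (tree normalisation `Literature/NumberTheory/LFunctions/WeilExplicit.lean`, `WeilSemilocalQuadratic.lean`)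

* `nextPrime q` = the least prime `> q` (`q⁺`); `consecutivePrimes_nextPrime : ConsecutivePrimes q q⁺` for `q` prime;
* `HandoffH q := Handoff.HandoffH q (nextPrime q)` — the directive's ONE-ARGUMENT `H(q)`: for every half-width
  `t ∈ [(log q)/2, (log q⁺)/2]` and every `g ∈ C(t)` (`IsWeilTest`, `tsupport g ⊆ [−t, t]`; complex `C_c^∞`, no parity
  restriction), `deficit q g ≤ contribution q g`, where (prove-2's defs) `deficit q g = − Re Q_{S_q}(g)`,
  `S_q = Nat.primesBelow q` (ALL powers `p^m` of the primes `p < q` are inside the old form), and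
  `contribution q g = −(log q/√q)·Re(k(log q) + k(−log q))`, `k = g ⋆ g̃` — the single atom `q`, which IS the whole
  place `q` on the window (`contribution_eq_place`: by Bertrand `q⁺ ≤ 2q ≤ q²` no higher power of `q` is visible);
* `HandoffBase := WeilPositivityOn ((log 2)/2)` (the zeroth window: no prime visible; Yoshida 1992 Thm 1, tree);
* `HandoffStep q := WeilPositivityOn ((log q)/2) → HandoffH q` (the one-window INCREMENT form `H′(q)`);
* `HandoffTarget := RiemannHypothesis ↔ (HandoffBase ∧ ∀ q, q.Prime → HandoffH q)`.

## What is proved (standard axioms; no named facts, no sorry)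

* `handoffH_iff_weilPositivityOn : HandoffH q ↔ WeilPositivityOn ((log q⁺)/2)` (q prime) and its semi-local /
  THRESHOLD forms `handoffH_iff_weilSemilocalPositivityOn`, `handoffH_iff_wallOffset : HandoffH q ↔ (log q⁺)/2 ≤
  a*({p ≤ q})` (the cell's wall offset `δ*(q⁺) ≥ 0`); nesting `HandoffH.anti`; `handoffH_two`; `handoffBase_holds`;
* `riemannHypothesis_iff_forall_handoffH : RH ↔ ∀ q prime, HandoffH q` and THE TARGET `handoffTarget_holds :
  RH ↔ (Base ∧ ∀ q prime, H q)` — BOTH directions, no side condition, no limit interchange (every compact support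
  lies in one window; Base is redundant here by antitonicity);
* the THRESHOLD form `riemannHypothesis_iff_forall_log_half_le_weilSemilocalThreshold : RH ↔ ∀ q prime,
  (log q)/2 ≤ a*({p < q})` — all wall offsets `δ*(q) ≥ 0` iff RH (the cell's C-I(a) LOWER clause, non-strict);
* the INCREMENT form `riemannHypothesis_iff_base_and_forall_handoffStep : RH ↔ Base ∧ ∀ q prime, HandoffStep q`
  (induction along the primes; here Base is NOT redundant).
`HandoffDecompositionConsequences.lean` adds: the left end of the window, `H(3) ↔ WeilPositivityOn((log 5)/2)`, the
first failing window under `¬RH`, the VACUITY TRAP `∃ q₀, ∀ q ≥ q₀, HandoffStep q` (a theorem by excluded middle),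
and the aggregate (Rayleigh-quotient) shadow with `RH ↔ NormBound(q) for infinitely many q`.

References: Weil 1952 [Weil1952FormulesExplicites]; Bombieri, Rend. Lincei (9) 11 (2000) Thm 2, §4 [Bombieri2000Weil];
Yoshida, Adv. Stud. Pure Math. 21 (1992) Thm 1, Prop. 6 [Yoshida1992HermitianForms]; Connes, Selecta 5 (1999) §VII
Thm 4 [Connes1999]; Connes–Consani, Enseign. Math. 69 (2023) §2.1.2, §2.2–2.4 («when λ² grows past a prime power and
one ignores its contribution, QW_λ fails to remain positive … displayed up to λ² ∼ 7») [ConnesConsani2023].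
-/

set_option linter.dupNamespace false  -- the mandated namespace repeats `RiemannHypothesis`

noncomputable section

open Set Literature.NumberTheory.LFunctions
open Summit.RiemannHypothesis.RiemannHypothesis.Theorems.MotivicDoor.Semilocal
open Summit.RiemannHypothesis.RiemannHypothesis.Theorems.MotivicDoor.SemilocalThreshold
open scoped ComplexConjugate

namespace Summit.RiemannHypothesis.RiemannHypothesis.Theorems.HandoffDecomposition

variable {q : ℕ} {g : ℝ → ℂ}

/-! ## §1  The next prime and the one-argument window -/

/-- The next prime after `q`: the least prime `p` with `q < p` (Euclid, `Nat.exists_infinite_primes`). [folklore] -/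
def nextPrime (q : ℕ) : ℕ := Nat.find (Nat.exists_infinite_primes (q + 1))

/-- `q < q⁺`. [folklore] -/
theorem lt_nextPrime (q : ℕ) : q < nextPrime q := (Nat.find_spec (Nat.exists_infinite_primes (q + 1))).1

/-- `q⁺` is prime. [folklore] -/
theorem nextPrime_prime (q : ℕ) : (nextPrime q).Prime := (Nat.find_spec (Nat.exists_infinite_primes (q + 1))).2

/-- Minimality: every prime `p > q` is `≥ q⁺`. [folklore] -/
theorem nextPrime_le {q p : ℕ} (hp : p.Prime) (hqp : q < p) : nextPrime q ≤ p :=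
  Nat.find_min' _ ⟨hqp, hp⟩

/-- No prime lies strictly between `q` and `q⁺`: a prime `p < q⁺` is `≤ q`. [folklore] -/
theorem le_of_prime_of_lt_nextPrime {q p : ℕ} (hp : p.Prime) (h : p < nextPrime q) : p ≤ q := by
  by_contra h'
  exact absurd (nextPrime_le hp (lt_of_not_ge h')) (not_le.2 h)

/-- `nextPrime 2 = 3`. [folklore] -/
theorem nextPrime_two : nextPrime 2 = 3 :=
  le_antisymm (nextPrime_le Nat.prime_three (by norm_num)) (Nat.succ_le_of_lt (lt_nextPrime 2))

/-- For `q` prime, `q < q⁺` are consecutive primes in the sense of `HandoffWindow.lean`. [folklore] -/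
theorem consecutivePrimes_nextPrime (hq : q.Prime) : Handoff.ConsecutivePrimes q (nextPrime q) :=
  ⟨hq, nextPrime_prime q, lt_nextPrime q, fun _ hp hqp ↦ nextPrime_le hp hqp⟩

/-- Consecutive primes `q < q'` have `q' = q⁺`. [folklore] -/
theorem nextPrime_eq_of_consecutivePrimes {q q' : ℕ} (h : Handoff.ConsecutivePrimes q q') : nextPrime q = q' :=
  le_antisymm (nextPrime_le h.2.1 h.2.2.1) (h.2.2.2 _ (nextPrime_prime q) (lt_nextPrime q))

/-- On the handoff window only the first power of `q` can be visible: `(log q⁺)/2 ≤ log q` for `q` prime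
(`q⁺ ≤ 2q ≤ q²`, Bertrand via `ConsecutivePrimes.le_two_mul`). [folklore] -/
theorem log_nextPrime_half_le_log (hq : q.Prime) : Real.log (nextPrime q) / 2 ≤ Real.log q := by
  have h1 : (nextPrime q : ℝ) ≤ 2 * q := by exact_mod_cast (consecutivePrimes_nextPrime hq).le_two_mul
  have h2 : (2 : ℝ) * q ≤ (q : ℝ) ^ 2 := by
    have : (2 : ℝ) ≤ q := by exact_mod_cast hq.two_le
    nlinarith
  have hpos : (0 : ℝ) < nextPrime q := by exact_mod_cast (nextPrime_prime q).pos
  have h3 : Real.log (nextPrime q) ≤ Real.log ((q : ℝ) ^ 2) := Real.log_le_log hpos (h1.trans h2)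
  rw [Real.log_pow] at h3; push_cast at h3; linarith

/-! ## §2  The statements -/

/-- **`H(q)`, the handoff condition at `q`** (one argument; the directive's form): prove-2's window statement for the
consecutive pair `(q, q⁺)` — for every half-width `t ∈ [(log q)/2, (log q⁺)/2]` and every Weil test function `g`
supported in `[−t, t]`, `deficit q g ≤ contribution q g`.  OPEN for every prime `q ≥ 3`; `H 2` is the tree's
`(log 3)/2` rung (`handoffH_two`). [cite: Bombieri2000Weil, §4 (Weil positivity on a window); Yoshida1992HermitianForms Prop. 6] -/
def HandoffH (q : ℕ) : Prop := Handoff.HandoffH q (nextPrime q)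

/-- **`Base`**: Weil positivity with NO prime visible, `WeilPositivityOn ((log 2)/2)` (the zeroth window; Yoshida,
Adv. Stud. Pure Math. 21 (1992) Thm. 1 p. 310 — PROVED in the tree, `handoffBase_holds`); logically redundant next to
`H 2` (antitonicity), essential next to `HandoffStep`.  A statement of THIS file (proved below), not a literature fact. -/
def HandoffBase : Prop := WeilPositivityOn (Real.log 2 / 2)

/-- **`H′(q)`, the one-window INCREMENT form**: IF the old form is non-negative where it still equals Weil's form
(`WeilPositivityOn ((log q)/2)`), THEN the handoff inequality holds on the window of `q`.  `RH ↔ Base ∧ ∀ q prime,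
HandoffStep q` with Base NOT redundant; beware `HandoffStep q` is VACUOUSLY true past Yoshida's break point under
`¬RH` (`HandoffDecompositionConsequences`). [cite: Yoshida1992HermitianForms, Prop. 6 (p. 320)] -/
def HandoffStep (q : ℕ) : Prop := WeilPositivityOn (Real.log q / 2) → HandoffH q

/-- **The target statement of TRACK «HANDOFF»**, as an `↔`.  BOTH directions are claimed and PROVED below
(`handoffTarget_holds`): it is Weil's criterion (Bombieri, Rend. Lincei (9) 11 (2000) Thm. 2, discharged in the tree as
`weil_criterion_holds`; Yoshida 1992 Prop. 6) re-indexed by the prime windows; no side condition.  It is NOT a route to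
RH by itself: `∀ q, H q` is RH.  A statement of THIS file (proved below), not a literature fact. -/
def HandoffTarget : Prop := Summit.RiemannHypothesis ↔ (HandoffBase ∧ ∀ q : ℕ, q.Prime → HandoffH q)

/-! ## §3  Honest accounting of the place `q`: on the window the atom IS the place -/

/-- **Only the first power of `q` is visible**: for `k` continuous with `tsupport k ⊆ [−2t, 2t]`, `t ≤ log q`
(q prime), the place-`q` Weil term `Σ_{m≥1} (log q) q^{−m/2}(k(m log q) + k(−m log q))` is the single atom
`(log q/√q)(k(log q) + k(−log q))`. [cite: Connes1999, §VII Thm 4 (the local Weil term at v = q)] -/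
theorem weilSemilocalPrimeTerm_singleton_eq (hq : q.Prime) {k : ℝ → ℂ} (hk : Continuous k) {t : ℝ}
    (ht : t ≤ Real.log q) (hks : tsupport k ⊆ Icc (-(2 * t)) (2 * t)) :
    weilSemilocalPrimeTerm {q} k = ((Real.log q / Real.sqrt q : ℝ) : ℂ) * (k (Real.log q) + k (-Real.log q)) := by
  have hq1 : 1 ≤ q ^ 2 := Nat.one_le_pow _ _ hq.pos
  have hcast : ((q ^ 2 - 1 : ℕ) : ℝ) + 1 = (q : ℝ) ^ 2 := by exact_mod_cast Nat.sub_add_cancel hq1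
  have hlog : 2 * t ≤ Real.log (((q ^ 2 - 1 : ℕ) : ℝ) + 1) := by
    rw [hcast, Real.log_pow]; push_cast; linarith
  have hks' : tsupport k ⊆ Icc (-Real.log (((q ^ 2 - 1 : ℕ) : ℝ) + 1)) (Real.log (((q ^ 2 - 1 : ℕ) : ℝ) + 1)) :=
    hks.trans (Icc_subset_Icc (neg_le_neg hlog) hlog)
  rw [weilSemilocalPrimeTerm_eq_sum_of_tsupport_subset {q} hk _ hks', Nat.sub_add_cancel hq1,
    Finset.sum_eq_single q]
  · unfold weilSemilocalCoeff
    rw [hq.primeFactors, if_pos (Finset.Subset.refl _), ArithmeticFunction.vonMangoldt_apply_prime hq]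
  · intro n hn hne
    by_cases hpp : IsPrimePow n
    · obtain ⟨p, m, hp, hm, rfl⟩ := (isPrimePow_nat_iff n).1 hpp
      have hpf : (p ^ m).primeFactors = {p} := Nat.primeFactors_prime_pow hm.ne' hp
      by_cases hpq : p = q
      · subst hpq
        have hlt : p ^ m < p ^ 2 := Finset.mem_range.1 hn
        have hm2 : m < 2 := (Nat.pow_lt_pow_iff_right hp.one_lt).1 hlt
        interval_cases m
        exact absurd (pow_one _) hne
      · unfold weilSemilocalCoeff
        rw [hpf, if_neg (by simpa using hpq)]
        simp
    · simp [weilSemilocalCoeff_of_not_isPrimePow _ hpp]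
  · intro h
    exact absurd (Finset.mem_range.2 (by nlinarith [hq.one_lt])) h

/-- **The atom is the place**: for `q` prime and `g ∈ C(t)`, `t ≤ log q` — so on the whole handoff window
(`log_nextPrime_half_le_log`) — prove-2's `contribution q g` (the single atom `q`) equals minus the real part of the
FULL place-`q` Weil term of `g ⋆ g̃` (all powers `q^m`): prime powers are handled honestly, none of `q` is dropped.
[cite: Connes1999, §VII Thm 4] -/
theorem contribution_eq_place (hq : q.Prime) (hg : IsWeilTest g) {t : ℝ} (ht : t ≤ Real.log q)
    (hsupp : tsupport g ⊆ Icc (-t) t) :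
    Handoff.contribution q g = -(weilSemilocalPrimeTerm {q} (weilConv g (weilReflect g))).re := by
  have hk : IsWeilTest (weilConv g (weilReflect g)) := hg.weilConv hg.weilReflect
  have hks := tsupport_weilConv_weilReflect_subset (a := t) hg.2 hsupp
  unfold Handoff.contribution
  rw [weilSemilocalPrimeTerm_singleton_eq hq hk.1.continuous ht hks, Complex.re_ofReal_mul]

/-- The contribution in the cell's `w_q Re k(log q)` form: `contribution q g = −(2 log q/√q)·Re k(log q)`
(`k(−x) = conj k(x)`; no hypothesis on `g`). [folklore] -/
theorem contribution_eq_two_mul (q : ℕ) (g : ℝ → ℂ) :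
    Handoff.contribution q g = -(2 * Real.log q / Real.sqrt q * (weilConv g (weilReflect g) (Real.log q)).re) := by
  unfold Handoff.contribution
  rw [Complex.add_re, ← conj_weilConv_weilReflect_neg g (-Real.log q), neg_neg, Complex.conj_re]
  ring

/-! ## §4  The logical status -/

/-- **`H(q)` IS Weil positivity on the window's right end** (q prime): `HandoffH q ↔ WeilPositivityOn ((log q⁺)/2)`
(prove-2's `Handoff.handoffH_iff_weilPositivityOn` at the pair `(q, q⁺)`). [cite: Bombieri2000Weil, §4] -/
theorem handoffH_iff_weilPositivityOn (hq : q.Prime) :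
    HandoffH q ↔ WeilPositivityOn (Real.log (nextPrime q) / 2) :=
  Handoff.handoffH_iff_weilPositivityOn (consecutivePrimes_nextPrime hq)

/-- `((q⁺ − 1 : ℕ) : ℝ) + 1 = q⁺` (window bookkeeping). [folklore] -/
theorem cast_nextPrime_pred_add_one (q : ℕ) : ((nextPrime q - 1 : ℕ) : ℝ) + 1 = (nextPrime q : ℝ) := by
  exact_mod_cast Nat.sub_add_cancel (nextPrime_prime q).one_lt.le

/-- Semi-local form: `H(q) ↔ WeilSemilocalPositivityOn {p ≤ q} ((log q⁺)/2)` (q prime) — on the window Weil's form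
IS the `{p < q⁺}`-form (locality). [cite: ConnesConsani2023, §2.1.2 and Prop. 2.1 (only the prime powers n ≤ λ² enter QW_λ)] -/
theorem handoffH_iff_weilSemilocalPositivityOn (hq : q.Prime) :
    HandoffH q ↔ WeilSemilocalPositivityOn (Nat.primesBelow (nextPrime q)) (Real.log (nextPrime q) / 2) := by
  have hS : ∀ n ≤ nextPrime q - 1, IsPrimePow n → n.primeFactors ⊆ Nat.primesBelow (nextPrime q - 1 + 1) :=
    fun n hn _ ↦ primeFactors_subset_primesBelow hn
  rw [Nat.sub_add_cancel (nextPrime_prime q).one_lt.le] at hS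
  have h := weilSemilocalPositivityOn_iff_weilPositivityOn_of_forall hS
  rw [cast_nextPrime_pred_add_one] at h
  rw [handoffH_iff_weilPositivityOn hq, h]

/-- **Threshold (wall-offset) form**: `H(q) ↔ (log q⁺)/2 ≤ a*({p ≤ q})`, i.e. `H(q)` says the cell's wall offset
`δ*(q⁺) = a*({p < q⁺}) − (log q⁺)/2` is `≥ 0` (q prime; `a* = weilSemilocalThreshold`, an honest maximum).
[cite: Yoshida1992HermitianForms, Prop. 6 (threshold), with the primes restricted to S] -/
theorem handoffH_iff_wallOffset (hq : q.Prime) :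
    HandoffH q ↔ Real.log (nextPrime q) / 2 ≤ weilSemilocalThreshold (Nat.primesBelow (nextPrime q)) := by
  rw [handoffH_iff_weilSemilocalPositivityOn hq, weilSemilocalPositivityOn_iff_le_weilSemilocalThreshold]

/-- **The `H(q)` are nested**: `H(q) → H(q')` for primes `q' ≤ q`. [folklore] -/
theorem HandoffH.anti {q q' : ℕ} (hq : q.Prime) (hq' : q'.Prime) (hle : q' ≤ q) (h : HandoffH q) :
    HandoffH q' := by
  refine Handoff.handoffH_anti (consecutivePrimes_nextPrime hq') (consecutivePrimes_nextPrime hq) ?_ h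
  exact nextPrime_le (nextPrime_prime q) (lt_of_le_of_lt hle (lt_nextPrime q))

/-- `Base` holds (Yoshida 1992 Thm 1, tree `weilPositivityOn_log_two_half_holds`). [cite: Yoshida1992HermitianForms, Thm. 1 (p. 310)] -/
theorem handoffBase_holds : HandoffBase := weilPositivityOn_of_le_log_two_half le_rfl

/-- **`H(2)` holds**: the tree's first-prime rung `WeilPositivityOn ((log 3)/2)` (prove-2's `handoffH_two_three`).
[cite: Yoshida1992HermitianForms, §6 (method); certificate in tree `weilPositivityOn_log_three_half`] -/
theorem handoffH_two : HandoffH 2 := by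
  unfold HandoffH
  rw [nextPrime_two]
  exact Handoff.handoffH_two_three

/-- RH gives every `H(q)`. [cite: Bombieri2000Weil, Thm. 2 (⇒)] -/
theorem handoffH_of_riemannHypothesis (hRH : Summit.RiemannHypothesis) (hq : q.Prime) : HandoffH q := by
  rw [handoffH_iff_weilPositivityOn hq]
  refine MotivicDoor.Rungs.rung_of_riemannHypothesis hRH ?_
  have := Real.log_pos (show (1 : ℝ) < nextPrime q by exact_mod_cast (nextPrime_prime q).one_lt)
  positivity

/-- **`RH ↔ ∀ q prime, H(q)`** (one-argument form of prove-2's `Handoff.riemannHypothesis_iff_forall_handoffH`: a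
consecutive pair `(q, q')` is `(q, q⁺)`). [cite: Bombieri2000Weil, Thm. 2; Yoshida1992HermitianForms Prop. 6] -/
theorem riemannHypothesis_iff_forall_handoffH :
    Summit.RiemannHypothesis ↔ ∀ q : ℕ, q.Prime → HandoffH q := by
  refine ⟨fun hRH q hq ↦ handoffH_of_riemannHypothesis hRH hq, fun h ↦ ?_⟩
  rw [Summit.RiemannHypothesis_iff, Handoff.riemannHypothesis_iff_forall_handoffH]
  intro q q' hqq'
  have := h q hqq'.1
  unfold HandoffH at this
  rwa [nextPrime_eq_of_consecutivePrimes hqq'] at this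

/-- **THE TARGET IS A THEOREM: `RH ↔ (Base ∧ ∀ q prime, H(q))`.** Both directions; standard axioms; the content is
Weil's criterion as discharged in the tree.  (It does not bring RH nearer: each `H(q)`, `q ≥ 3`, is open and
their conjunction is RH.) [cite: Bombieri2000Weil, Thm. 2; Yoshida1992HermitianForms Thm. 1, Prop. 6] -/
theorem handoffTarget_holds : HandoffTarget := by
  unfold HandoffTarget
  rw [riemannHypothesis_iff_forall_handoffH]
  exact ⟨fun h ↦ ⟨handoffBase_holds, h⟩, fun h ↦ h.2⟩

/-! ## §5  The threshold form and the increment form of the target -/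

/-- **Wall-offset form of the target: `RH ↔ ∀ q prime, (log q)/2 ≤ a*({p < q})`** — all wall offsets
`δ*(q) = a*({p<q}) − (log q)/2` are `≥ 0` iff RH (the cell's C-I(a) LOWER clause, non-strict, for every prime; the
tree's `riemannHypothesis_iff_forall_le_weilSemilocalThreshold` re-indexed by primes).
[cite: Yoshida1992HermitianForms, Prop. 6; Bombieri2000Weil §4] -/
theorem riemannHypothesis_iff_forall_log_half_le_weilSemilocalThreshold :
    Summit.RiemannHypothesis ↔
      ∀ q : ℕ, q.Prime → Real.log q / 2 ≤ weilSemilocalThreshold (Nat.primesBelow q) := by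
  rw [riemannHypothesis_iff_forall_le_weilSemilocalThreshold]
  constructor
  · intro h q hq
    have := h (q - 1)
    rwa [Nat.sub_add_cancel hq.one_lt.le, show ((q - 1 : ℕ) : ℝ) + 1 = q by
      exact_mod_cast Nat.sub_add_cancel hq.one_lt.le] at this
  · intro h N
    -- the least prime `P ≥ N + 1` has the same primes below it as `N + 1`, and `log (N+1) ≤ log P`
    have hP := h (nextPrime N) (nextPrime_prime N)
    have hset : Nat.primesBelow (nextPrime N) = Nat.primesBelow (N + 1) := by
      ext p
      simp only [Nat.mem_primesBelow]
      constructor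
      · rintro ⟨hp, hpp⟩
        exact ⟨Nat.lt_succ_of_le (le_of_prime_of_lt_nextPrime hpp hp), hpp⟩
      · rintro ⟨hp, hpp⟩
        exact ⟨lt_of_le_of_lt (Nat.le_of_lt_succ hp) (lt_nextPrime N), hpp⟩
    rw [hset] at hP
    refine le_trans ?_ hP
    have h1 : (N : ℝ) + 1 ≤ nextPrime N := by exact_mod_cast Nat.succ_le_of_lt (lt_nextPrime N)
    have h2 := Real.log_le_log (by positivity) h1
    linarith

/-- If `n + 1` is not prime, `nextPrime (n + 1) = nextPrime n`. [folklore] -/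
theorem nextPrime_succ_of_not_prime {n : ℕ} (h : ¬ (n + 1).Prime) : nextPrime (n + 1) = nextPrime n := by
  refine le_antisymm (nextPrime_le (nextPrime_prime n) ?_) (nextPrime_le (nextPrime_prime (n + 1)) ?_)
  · rcases (Nat.succ_le_of_lt (lt_nextPrime n)).eq_or_lt with h' | h'
    · have h'' : n + 1 = nextPrime n := h'
      exact absurd (by rw [h'']; exact nextPrime_prime n) h
    · exact h'
  · exact lt_of_le_of_lt (Nat.le_succ n) (lt_nextPrime (n + 1))

/-- If `n + 1` is prime, `nextPrime n = n + 1`. [folklore] -/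
theorem nextPrime_eq_succ_of_prime {n : ℕ} (h : (n + 1).Prime) : nextPrime n = n + 1 :=
  le_antisymm (nextPrime_le h (Nat.lt_succ_self n)) (Nat.succ_le_of_lt (lt_nextPrime n))

/-- `nextPrime 1 = 2`. [folklore] -/
theorem nextPrime_one : nextPrime 1 = 2 := nextPrime_eq_succ_of_prime Nat.prime_two

/-- **The increment form of the target: `RH ↔ Base ∧ ∀ q prime, HandoffStep q`** — induction along the primes:
Base is Weil positivity on the zeroth window, and the step at `q` carries `WeilPositivityOn ((log q)/2)` to
`WeilPositivityOn ((log q⁺)/2)`.  Here Base is NOT redundant (without it every step could hold vacuously).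
[cite: Yoshida1992HermitianForms, Prop. 6; Bombieri2000Weil Thm. 2] -/
theorem riemannHypothesis_iff_base_and_forall_handoffStep :
    Summit.RiemannHypothesis ↔ (HandoffBase ∧ ∀ q : ℕ, q.Prime → HandoffStep q) := by
  constructor
  · intro hRH
    exact ⟨handoffBase_holds, fun q hq _ ↦ handoffH_of_riemannHypothesis hRH hq⟩
  · rintro ⟨hB, hS⟩
    -- by induction on `n ≥ 1`: Weil positivity on `C((log (nextPrime n))/2)`
    have key : ∀ n : ℕ, 1 ≤ n → WeilPositivityOn (Real.log (nextPrime n) / 2) := by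
      intro n hn
      induction n with
      | zero => exact absurd hn (by norm_num)
      | succ m ih =>
        rcases Nat.eq_zero_or_pos m with rfl | hm
        · rw [zero_add, nextPrime_one]; exact_mod_cast hB
        · by_cases hp : (m + 1).Prime
          · have h1 : WeilPositivityOn (Real.log ((m + 1 : ℕ) : ℝ) / 2) := by
              have := ih hm
              rwa [nextPrime_eq_succ_of_prime hp] at this
            exact (handoffH_iff_weilPositivityOn hp).1 (hS _ hp h1)
          · rw [nextPrime_succ_of_not_prime hp]; exact ih hm
    rw [riemannHypothesis_iff_forall_handoffH]
    intro q hq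
    rw [handoffH_iff_weilPositivityOn hq]
    exact key q hq.one_lt.le

end Summit.RiemannHypothesis.RiemannHypothesis.Theorems.HandoffDecomposition

end
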